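import Summits.BirchSwinnertonDyer.BirchSwinnertonDyer.Theses.PAdicOrderV2
import Summits.BirchSwinnertonDyer.BirchSwinnertonDyer.Theses.HigherGrossZagier
import Summits.BirchSwinnertonDyer.BirchSwinnertonDyer.Theorems.HigherGrossZagierGram
import Literature.NumberTheory.EllipticCurves.OrdinaryPrimesProofs
import Literature.NumberTheory.EllipticCurves.HeightsProofs
import Literature.NumberTheory.EllipticCurves.MordellWeilTheoremProofs
import Literature.NumberTheory.EllipticCurves.AnalyticRankOrderProofs
import Literature.NumberTheory.EllipticCurves.AnalyticRankModularityProofs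
import Summits.BirchSwinnertonDyer.BirchSwinnertonDyer.Theorems.PAdicOrderV2PAdicOrderThesisR2StubUBRank0
import Summits.BirchSwinnertonDyer.BirchSwinnertonDyer.Theorems.PAdicOrderV2PAdicOrderThesisR2StubLBRank1

/-!
# BirchSwinnertonDyer / PAdicOrderV2 — crux `PAdicOrderThesisR2` (stmt-0487), line `Sketch`:
# wiring of the open stubs to existing route items

The Kato-sandwich skeleton of line `Sketch` (`Cruxes/PAdicOrderThesisR2/Lines/Sketch.lean`) proves
the crux `X = PAdicOrderThesisR2` modulo five registered stubs (`padicOrderThesisR2_of_sandwich`,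
`Theorems/PAdicOrderV2PAdicOrderThesisR2StubUBRank0.lean`). Three of them are named facts or route
items verbatim (`stub_modularity` = `ModularForms.exists_isNewformOf`, `stub_kato` =
`PAdicOrderKatoSideR2`, `stub_LB_rank1` ⟸ `rank_eq_analyticRank_of_analyticRank_le_one`). This
file places the two OPEN stubs among the EXISTING items of the BSD routes, sorry-free:

* `stub_UB_pos_of_comparison` — the positive-rank one-prime upper bound `stub_UB_pos`
  (`0 < r_an ⇒ ∃ good ordinary p ≥ 5, ∀ newform f, ord_T L_p(f, α_p, T) ≤ r_an`) follows from
  route crux #2 `PAdicOrderComparisonR2` (stmt-BirchSwinnertonDyer-0489: `ord_T L_p = r_an` at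
  EVERY good ordinary prime) at the prime of `exists_good_ordinary_prime_holds` (Serre 1981, §8,
  proved in the tree); `stub_UB_pos_rank1_of_rankOne` — its analytic-rank-1 case follows likewise
  from crux #5 `PAdicOrderRankOneR4` (stmt-BirchSwinnertonDyer-0515).
* `analyticRank_eq_mordellWeilRank_of_thesis`, `stub_LB_ge2_of_thesis`, `stub_LB_rank1_of_thesis`
  — the lower-bound stubs are NECESSARY: `X` itself implies `r_an = r_MW` for globally minimal
  models, hence both `stub_LB_ge2` and `stub_LB_rank1`. No line for `X` can avoid the lower-bound
  half of BSD (cf. the disprover's `thesis_iff_bsd_and_onePrime`).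
* `le_mordellWeilRank_of_higherGZConstruction`, `stub_LB_ge2_of_higherGZConstruction` —
  `stub_LB_ge2` (`2 ≤ r_an ⇒ r_an ≤ r_MW`) follows from the construction crux
  `HigherGZConstructionR2` of route HigherGrossZagier (stmt-BirchSwinnertonDyer-0501: `r_an`
  rational points whose Néron–Tate regulator is a positive multiple of `L^{(r)}(E,1)/r!`) through
  three tree theorems: `leadingLCoeff_ne_zero_holds` (`L^{(r)}(E,1) ≠ 0` for an entire `L`),
  the Gram lemma `Literature.EllArith.gram_lemma` (non-zero Gram determinant ⇒ independence ⇒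
  `n ≤ rank`, using the proved Mordell–Weil theorem `module_finite_point_holds` and additivity of
  the pairing `heightPairing_add_left_holds`). The only extra hypothesis is that `L(E, s)` be entire
  (per curve; in the skeleton this is `IsNewformOf.hasEntireLFunction` of the newform of
  `stub_modularity`).

* `padicOrderThesisR2_of_items` — consequently `X` follows from EXISTING declarations only:
  modularity (`ModularForms.exists_isNewformOf`, cite-only fact, BCDT 2001), the Kato side
  `PAdicOrderKatoSideR2` (support item stmt-0491), crux #2 `PAdicOrderComparisonR2` (stmt-0489),
  rank-one Gross–Zagier over `ℚ` (`WeierstrassCurve.gross_zagier_rank_one_rat`, named fact) and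
  `HigherGZConstructionR2` (stmt-0501) — by `padicOrderThesisR2_of_sandwich`. Compared with the
  route glue `CruxesToThesis` (`X ⟸` modularity `∧` #2 `∧` #3), the sandwich trades crux #3
  `PAdicOrderPadicBSDrankR2` (`ord_T L_p = r_MW` at EVERY good ordinary prime, i.e. `Ш[p^∞]`
  cotorsion and Schneider non-degeneracy at every such `p`) for Kato's proved-in-print inequality
  plus the classical lower bound of BSD.

So, modulo named facts, the open residue of line `Sketch` is {crux #2 (or, in rank 1, crux #5),
the rank-≥ 2 lower bound of BSD}, the latter sitting between `SqueezeOnePoint` (stmt-0143, weaker)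
and `HigherGZConstructionR2` (stmt-0501, stronger). Nothing here is asserted unconditionally about
`X`; every theorem is an implication between existing route declarations and named facts.
-/

-- single-conjunct summit: `Summit.BirchSwinnertonDyer.BirchSwinnertonDyer.…` repeats the name by design
set_option linter.dupNamespace false

namespace Summit.BirchSwinnertonDyer.BirchSwinnertonDyer.Cruxes.PAdicOrderThesisR2.KatoSandwich

open Literature.NumberTheory.EllipticCurves Literature.NumberTheory.EllipticCurves.ModularForms
open Summit.BirchSwinnertonDyer.BirchSwinnertonDyer.Theses

/-- **`stub_UB_pos` from crux #2.** If `PAdicOrderComparisonR2` holds (stmt-BirchSwinnertonDyer-0489: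
`ord_{T=0} L_p(f, α_p, T) = r_an(E)` at every good ordinary prime `p`, for every newform `f` of
`E`), then every `E/ℚ` (globally minimal `W`) of positive analytic rank has a good ordinary prime
`p ≥ 5` with `ord_{T=0} L_p(f, α_p, T) ≤ r_an(E)` for every newform `f`: take the prime of
`exists_good_ordinary_prime_holds` (Serre 1981, §8: supersingular primes have density `0` or `1/2`).
The conclusion is the registered signature of `stub_UB_pos` (line `Sketch`).
[cite: MazurTateTeitelbaum1986Invent, §II.10] -/
theorem stub_UB_pos_of_comparison :
    PAdicOrderV2.PAdicOrderComparisonR2 →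
    ∀ (W : WeierstrassCurve ℚ) [W.IsElliptic] [W.IsGloballyMinimal], 0 < W.analyticRank →
      ∃ (p : ℕ) (_ : Fact p.Prime), 5 ≤ p ∧ IsOrdinaryAt W p ∧
        ∀ {N : ℕ} [NeZero N] (f : CuspForm (CongruenceSubgroup.Gamma0 N) 2), IsNewformOf W f →
          (padicLFunction f (unitRoot W p : ℚ_[p])).order ≤ (W.analyticRank : ℕ∞) := by
  intro hC W _ _ _
  obtain ⟨p, hp, h5, hgood, hord⟩ := WeierstrassCurve.exists_good_ordinary_prime_holds W
  exact ⟨p, hp, h5, ⟨hgood, hord⟩, fun f hf ↦ (hC W p ⟨hgood, hord⟩ f hf).le⟩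

/-- **`stub_UB_pos` in analytic rank one from crux #5.** If `PAdicOrderRankOneR4` holds
(stmt-BirchSwinnertonDyer-0515: `r_an(E) = 1 ⇒ ord_{T=0} L_p(f, α_p, T) = 1` at every good ordinary
`p`), then every `E/ℚ` (globally minimal `W`) of analytic rank `1` has a good ordinary prime `p ≥ 5`
(`exists_good_ordinary_prime_holds`) with `ord_{T=0} L_p(f, α_p, T) ≤ r_an(E)` for every newform
`f` — the rank-one case of `stub_UB_pos`. (Perrin-Riou 1987 reduces crux #5 at `p` to the
non-vanishing of one cyclotomic `p`-adic height; see `stub_UB_pos_rank1_of_height_ne_zero`.)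
[cite: PerrinRiou1987, Thm. 1.3] -/
theorem stub_UB_pos_rank1_of_rankOne (hR : PAdicOrderV2.PAdicOrderRankOneR4) :
    ∀ (W : WeierstrassCurve ℚ) [W.IsElliptic] [W.IsGloballyMinimal], W.analyticRank = 1 →
      ∃ (p : ℕ) (_ : Fact p.Prime), 5 ≤ p ∧ IsOrdinaryAt W p ∧
        ∀ {N : ℕ} [NeZero N] (f : CuspForm (CongruenceSubgroup.Gamma0 N) 2), IsNewformOf W f →
          (padicLFunction f (unitRoot W p : ℚ_[p])).order ≤ (W.analyticRank : ℕ∞) := by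
  intro W _ _ h1
  obtain ⟨p, hp, h5, hgood, hord⟩ := WeierstrassCurve.exists_good_ordinary_prime_holds W
  refine ⟨p, hp, h5, ⟨hgood, hord⟩, fun f hf ↦ ?_⟩
  rw [hR W p ⟨hgood, hord⟩ h1 f hf, h1, Nat.cast_one]

/-- **`X` implies BSD-rank for globally minimal models.** If `PAdicOrderThesisR2` holds then
`r_an(E) = r_MW(E)` for every elliptic `E/ℚ` given by a global minimal model: the two equalities
of `X` at its witness prime share the left-hand side `ord_{T=0} L_p`, and `ℕ → ℕ∞` is injective.
(The `BSDgm` half of the disprover's normal form `X ↔ BSDgm ∧ OnePrimeComparison`.)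
[cite: MazurTateTeitelbaum1986Invent, §II.10] -/
theorem analyticRank_eq_mordellWeilRank_of_thesis (hX : PAdicOrderV2.PAdicOrderThesisR2)
    (W : WeierstrassCurve ℚ) [W.IsElliptic] [W.IsGloballyMinimal] :
    W.analyticRank = W.mordellWeilRank := by
  obtain ⟨p, hp, -, N, hN, f, -, han, hmw⟩ := hX W
  exact_mod_cast han.symm.trans hmw

/-- **`stub_LB_ge2` is necessary for `X`.** `PAdicOrderThesisR2` implies the registered signature
of `stub_LB_ge2` (`2 ≤ r_an ⇒ r_an ≤ r_MW` for globally minimal models): immediate from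
`analyticRank_eq_mordellWeilRank_of_thesis`. So the lower-bound half of BSD in rank `≥ 2` is not an
artefact of the sandwich: every proof of `X` contains one. [cite: MazurTateTeitelbaum1986Invent, §II.10] -/
theorem stub_LB_ge2_of_thesis (hX : PAdicOrderV2.PAdicOrderThesisR2) :
    ∀ (W : WeierstrassCurve ℚ) [W.IsElliptic] [W.IsGloballyMinimal],
      2 ≤ W.analyticRank → W.analyticRank ≤ W.mordellWeilRank :=
  fun W _ _ _ ↦ (analyticRank_eq_mordellWeilRank_of_thesis hX W).le

/-- **`stub_LB_rank1` is necessary for `X`.** `PAdicOrderThesisR2` implies the registered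
signature of `stub_LB_rank1` (`r_an = 1 ⇒ 1 ≤ r_MW` for globally minimal models).
[cite: MazurTateTeitelbaum1986Invent, §II.10] -/
theorem stub_LB_rank1_of_thesis (hX : PAdicOrderV2.PAdicOrderThesisR2) :
    ∀ (W : WeierstrassCurve ℚ) [W.IsElliptic] [W.IsGloballyMinimal],
      W.analyticRank = 1 → 1 ≤ W.mordellWeilRank := by
  intro W _ _ h1
  rw [← h1]
  exact (analyticRank_eq_mordellWeilRank_of_thesis hX W).le

/-- **BSD lower bound from a higher Gross–Zagier datum.** If `HigherGZConstructionR2` holds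
(stmt-BirchSwinnertonDyer-0501: for `r_an(E) ≥ 2` there are `r_an` points `P_i ∈ E(ℚ)` and `c > 0`
with `L^{(r)}(E,1)/r! = c · det ⟨P_i, P_j⟩`), then for every elliptic `E/ℚ` whose `L`-function is
entire and with `r_an(E) ≥ 2`, `r_an(E) ≤ rank_ℤ E(ℚ)`: the leading Taylor coefficient is non-zero
(`leadingLCoeff_ne_zero_holds`), so the Gram determinant is non-zero, so the `P_i` are
`ℤ`-independent and `r_an ≤ rank` by the Gram lemma (`Literature.EllArith.gram_lemma`, with the
proved Mordell–Weil theorem `module_finite_point_holds` and the additivity of the Néron–Tate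
pairing `heightPairing_add_left_holds`, Silverman AEC VIII.9.3(c)). This is the argument of
`Literature.EllArith.higherGZ_assembly`, per curve and without the upper bound. [folklore] -/
theorem le_mordellWeilRank_of_higherGZConstruction
    (hGZ : HigherGrossZagier.HigherGZConstructionR2) (W : WeierstrassCurve ℚ) [W.IsElliptic]
    (hE : W.HasEntireLFunction) (h2 : 2 ≤ W.analyticRank) :
    W.analyticRank ≤ W.mordellWeilRank := by
  obtain ⟨P, c, _hc, hL⟩ := hGZ W h2
  have hne : W.leadingLCoeff ≠ 0 := WeierstrassCurve.leadingLCoeff_ne_zero_holds (W := W) hE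
  have hdet : (Matrix.of fun i j => (P i).heightPairing (P j)).det ≠ 0 := by
    intro h0
    apply hne
    rw [hL, h0, mul_zero, Complex.ofReal_zero]
  exact Literature.EllArith.gram_lemma W (WeierstrassCurve.module_finite_point_holds W)
    WeierstrassCurve.Affine.Point.heightPairing_add_left_holds W.analyticRank P hdet

/-- **`stub_LB_ge2` from crux `HigherGZConstructionR2` (stmt-0501) and analytic continuation.**
If every elliptic `E/ℚ` has an entire `L`-function (`hasEntireLFunction_rat`; a consequence of
modularity, `hasEntireLFunction_rat_of_exists_isNewformOf`) and `HigherGZConstructionR2` holds,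
then the registered signature of `stub_LB_ge2` holds: `2 ≤ r_an ⇒ r_an ≤ r_MW` for globally minimal
models (`le_mordellWeilRank_of_higherGZConstruction`; global minimality is not used). [folklore] -/
theorem stub_LB_ge2_of_higherGZConstruction :
    WeierstrassCurve.hasEntireLFunction_rat → HigherGrossZagier.HigherGZConstructionR2 →
    ∀ (W : WeierstrassCurve ℚ) [W.IsElliptic] [W.IsGloballyMinimal],
      2 ≤ W.analyticRank → W.analyticRank ≤ W.mordellWeilRank :=
  fun hent hGZ W _ _ h2 ↦ le_mordellWeilRank_of_higherGZConstruction hGZ W (hent W) h2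

/-- **`X` from existing items and named facts only.** The crux `PAdicOrderThesisR2` follows from:
modularity `hmod` (`ModularForms.exists_isNewformOf`; Breuil–Conrad–Diamond–Taylor 2001, Thm A),
the Kato side `hkato` (`PAdicOrderKatoSideR2`, stmt-0491; Kato 2004, Thm 18.4), crux #2 `hC`
(`PAdicOrderComparisonR2`, stmt-0489), rank-one Gross–Zagier over `ℚ` `hGZ1`
(`gross_zagier_rank_one_rat`; Gross–Zagier 1986, Thm I.6.3 and §V.2) and the higher Gross–Zagier
construction `hGZ` (`HigherGZConstructionR2`, stmt-0501). Proof: `padicOrderThesisR2_of_sandwich`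
with `stub_UB_pos_of_comparison`, `stub_LB_rank1_of_gross_zagier_rank_one_rat` and
`stub_LB_ge2_of_higherGZConstruction` (analytic continuation from `hmod`,
`hasEntireLFunction_rat_of_exists_isNewformOf`). [cite: MazurTateTeitelbaum1986Invent, §II.10] -/
theorem padicOrderThesisR2_of_items :
    exists_isNewformOf → PAdicOrderV2.PAdicOrderKatoSideR2 → PAdicOrderV2.PAdicOrderComparisonR2 →
    WeierstrassCurve.gross_zagier_rank_one_rat → HigherGrossZagier.HigherGZConstructionR2 →
    PAdicOrderV2.PAdicOrderThesisR2 :=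
  fun hmod hkato hC hGZ1 hGZ ↦
  padicOrderThesisR2_of_sandwich hmod hkato (stub_UB_pos_of_comparison hC)
    (stub_LB_rank1_of_gross_zagier_rank_one_rat hGZ1)
    (stub_LB_ge2_of_higherGZConstruction
      (WeierstrassCurve.hasEntireLFunction_rat_of_exists_isNewformOf hmod) hGZ)

end Summit.BirchSwinnertonDyer.BirchSwinnertonDyer.Cruxes.PAdicOrderThesisR2.KatoSandwich
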